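import Mathlib
import HarnessLib
import Summits.NavierStokesRegularity.NavierStokesRegularity.Theorems.UnthreadedDoorNetFluxUnimodalScalarLiouville
import Summits.NavierStokesRegularity.NavierStokesRegularity.Theorems.UnthreadedDoorNetFluxNullTimeDenseFiniteZeroScalarLiouville

/-!
# Route `UnthreadedDoor`, crux `PoloidalLiouville` (stmt-NavierStokesRegularity-1222), WALL W1 — the TYPE-I DICHOTOMY after the third rung

`typeI_unthreaded_dichotomy` — the contrapositive reading of the K3ᵃᵉ rung `nullTimeDenseFiniteZeroScalarLiouvilleTypeI_holds` (p688761):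
a bounded ancient mild solution (duality form), Type-I in time, smooth on the past slab, unthreaded about `x₀` (`curl v = ∇T × (x − x₀)`,
`T` bounded and smooth off `x₀`, curled law (E1)) EITHER has `∇T × (x − x₀) ≡ 0` (so `ω ≡ 0`) OR is a PERSISTENT-SHEET configuration: for
every closed Lebesgue-null set `D` of times there are a time `t < 0`, `t ∉ D`, and an interval of radii `(a,b)`, `a > 0`, such that every
sphere `S_r(x₀)`, `r ∈ (a,b)`, carries infinitely many vorticity zeros.  `multiHillScalarLiouvilleTypeI_of_persistentSheet` — hence C⁻'s
named residual `NetFlux.MultiHillScalarLiouvilleTypeI` (p677092 carries it to C⁻ `PoloidalLiouvilleTypeI`) follows from the persistent-sheet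
residual (here as an unfolded hypothesis; the named form lands once the Defs twin `NetFlux.PersistentSheetResidualTypeI` is accepted).
HONEST: bookkeeping of where W1's Type-I face now stands; the residual is OPEN; `PoloidalLiouville` (1222), `stub_scalarLiouville`, W1 and NS
regularity are OPEN and not addressed.  `--supports stmt-NavierStokesRegularity-1222 --as helper`.  [folklore]
-/

noncomputable section

-- the summit and its single sub-problem share the name (CONVENTIONS §1)
set_option linter.dupNamespace false

open Set Function Filter Topology MeasureTheory
open scoped RealInnerProductSpace

namespace Summit.NavierStokesRegularity.NavierStokesRegularity.Theorems.PoloidalLiouville.NetFlux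

open Literature.Analysis Literature.Analysis.FluidPDE

/-- Non-density of a set `A` of radii in `(0,∞)` yields a whole open interval of positive radii missing `A` (port of the line's
`exists_Ioo_of_not_Ioi_subset_closure`, ns-idea-14). [folklore] -/
theorem exists_Ioo_of_not_Ioi_subset_closure' {A : Set ℝ} (h : ¬ (Ioi (0 : ℝ) ⊆ closure A)) :
    ∃ a b : ℝ, 0 < a ∧ a < b ∧ ∀ r ∈ Ioo a b, r ∉ A := by
  simp only [Set.not_subset] at h
  obtain ⟨r₀, hr₀, hcl⟩ := h
  rw [Metric.mem_closure_iff] at hcl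
  push Not at hcl
  obtain ⟨ε, hε, hfar⟩ := hcl
  refine ⟨r₀, r₀ + ε, hr₀, by linarith, fun r hr hrA => ?_⟩
  have := hfar r hrA
  rw [Real.dist_eq, abs_of_nonpos (by linarith [hr.1])] at this
  linarith [hr.2]

/-- **THE TYPE-I DICHOTOMY (contrapositive of the K3ᵃᵉ rung p688761).**  For Type-I bounded ancient mild data unthreaded about `x₀`:
EITHER `∇T × (x − x₀) ≡ 0` on `(−∞,0) × ℝ³`, OR the persistent-sheet configuration holds (for every closed null `D`, some time
`t ∉ D` and some interval of radii carry infinitely many vorticity zeros on each sphere). [folklore] -/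
theorem typeI_unthreaded_dichotomy :
    ∀ (v : ℝ → E3 → E3) (x₀ : E3) (T : ℝ → E3 → ℝ),
      (∃ C : ℝ, HasTypeITimeDecay C v) →
      IsBoundedAncientMildSolution 1 v →
      (∀ t < 0, AEStronglyMeasurable (v t) volume) →
      ContDiffOn ℝ (⊤ : ℕ∞) (uncurry v) (Iio 0 ×ˢ univ) →
      ContDiffOn ℝ (⊤ : ℕ∞) (uncurry T) (Iio 0 ×ˢ ({x₀}ᶜ : Set E3)) →
      (∃ C : ℝ, ∀ t < 0, ∀ x, |T t x| ≤ C) →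
      (∀ t < 0, ∀ x, curl (v t) x = cross (gradient (T t) x) (x - x₀)) →
      CurledLaw v x₀ T (Iio 0) →
      (∀ t < 0, ∀ x, cross (gradient (T t) x) (x - x₀) = 0) ∨
      (∀ D : Set ℝ, IsClosed D → volume D = 0 →
        ∃ t < 0, t ∉ D ∧ ∃ a b : ℝ, 0 < a ∧ a < b ∧ ∀ r ∈ Ioo a b,
          {x : E3 | x ∈ Metric.sphere x₀ r ∧ cross (gradient (T t) x) (x - x₀) = 0}.Infinite) := by
  intro v x₀ T hC hB hm hsv hsT hTb hrep hE
  by_cases hd : ∃ D : Set ℝ, IsClosed D ∧ volume D = 0 ∧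
      ∀ t < 0, t ∉ D → Ioi (0 : ℝ) ⊆ closure {r : ℝ | 0 < r ∧
        {x : E3 | x ∈ Metric.sphere x₀ r ∧ cross (gradient (T t) x) (x - x₀) = 0}.Finite}
  · exact Or.inl (nullTimeDenseFiniteZeroScalarLiouvilleTypeI_holds v x₀ T hC hB hm hsv hsT hTb hrep hE hd)
  · refine Or.inr fun D hDc hD0 => ?_
    push Not at hd
    obtain ⟨t, ht, htD, hnot⟩ := hd D hDc hD0
    obtain ⟨a, b, ha, hab, hbad⟩ := exists_Ioo_of_not_Ioi_subset_closure' hnot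
    refine ⟨t, ht, htD, a, b, ha, hab, fun r hr hfin => ?_⟩
    exact hbad r hr ⟨ha.trans hr.1, hfin⟩

/-- **C⁻'s named residual ⇐ the persistent-sheet residual** (hypothesis = the body of `NetFlux.PersistentSheetResidualTypeI`, unfolded):
if the persistent-sheet configurations with a non-unimodal sphere satisfy Type-I scalar Liouville, then so does every Type-I unthreaded
datum with a non-unimodal sphere (`MultiHillScalarLiouvilleTypeI`) — by the dichotomy. [folklore] -/
theorem multiHillScalarLiouvilleTypeI_of_persistentSheet
    (hres : ∀ (v : ℝ → E3 → E3) (x₀ : E3) (T : ℝ → E3 → ℝ),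
      (∃ C : ℝ, HasTypeITimeDecay C v) →
      IsBoundedAncientMildSolution 1 v →
      (∀ t < 0, AEStronglyMeasurable (v t) volume) →
      ContDiffOn ℝ (⊤ : ℕ∞) (uncurry v) (Iio 0 ×ˢ univ) →
      ContDiffOn ℝ (⊤ : ℕ∞) (uncurry T) (Iio 0 ×ˢ ({x₀}ᶜ : Set E3)) →
      (∃ C : ℝ, ∀ t < 0, ∀ x, |T t x| ≤ C) →
      (∀ t < 0, ∀ x, curl (v t) x = cross (gradient (T t) x) (x - x₀)) →
      CurledLaw v x₀ T (Iio 0) →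
      (∀ D : Set ℝ, IsClosed D → volume D = 0 →
        ∃ t < 0, t ∉ D ∧ ∃ a b : ℝ, 0 < a ∧ a < b ∧ ∀ r ∈ Ioo a b,
          {x : E3 | x ∈ Metric.sphere x₀ r ∧ cross (gradient (T t) x) (x - x₀) = 0}.Infinite) →
      (∃ t < 0, ∃ r > 0, ¬ IsUnimodalSphere (T t) x₀ r) →
      ∀ t < 0, ∀ x, cross (gradient (T t) x) (x - x₀) = 0) :
    MultiHillScalarLiouvilleTypeI := by
  intro v x₀ T hC hB hm hsv hsT hTb hrep hE hnu
  rcases typeI_unthreaded_dichotomy v x₀ T hC hB hm hsv hsT hTb hrep hE with h | h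
  · exact h
  · exact hres v x₀ T hC hB hm hsv hsT hTb hrep hE h hnu

end Summit.NavierStokesRegularity.NavierStokesRegularity.Theorems.PoloidalLiouville.NetFlux
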